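import Mathlib.Topology.Algebra.Group.OpenMapping
import Mathlib.Topology.Baire.LocallyCompactRegular
import Literature.AlgebraicGeometry.Frobenioids.QuasiTemperoidInductionFunctor
import Literature.AlgebraicGeometry.Frobenioids.QuasiTemperoidConnectedPart
import Literature.AlgebraicGeometry.Frobenioids.ArithmeticDivisorsPrimes
import Literature.IUT.HodgeTheaters.GlobalFrobenioidsArithmeticModel
import Literature.IUT.HodgeTheaters.GlobalFrobenioidsFmodFrobenioid
import HarnessLib

/-!
# [IUTchI] Example 5.1 (ii): the divisor data on a general `†𝒟^⊛` — pull-back of the arithmetic model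
# along `π₁(†𝒟^⊛) ↠ G_{F_mod}` — and `ℱ^⊛(†𝒟^⊚)` IS a Frobenioid there, too

Mochizuki, *Inter-universal Teichmüller theory I*, §5, Example 5.1 (i)–(ii), kurims manuscript (May 2020)
pp. 123, 125 ([IUTchI] Ex 5.1 (ii) p.125) [claim: Mochizuki2012, status: disputed]: `π₁(†𝒟^⊛)` is "a profinite
group corresponding to `C_{F_mod}`" with "a natural extension of the action of `π₁(†𝒟^⊚)` on `𝕄̄^⊛(†𝒟^⊚)`
[`≅ F̄`] to `π₁(†𝒟^⊛)`" (p. 123); `Φ^⊛(†𝒟^⊚)(A)` is "the monoid of arithmetic divisors on the corresponding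
subfield `𝕄̄^⊛(†𝒟^⊚)^A ⊆ 𝕄̄^⊛(†𝒟^⊚)` [i.e., the monoid denoted `Φ(−)` in [FrdI], Example 6.3]" (p. 125) — the
subfield of invariants of [the open subgroup of] `A`, which acts on `F̄` THROUGH `π₁(†𝒟^⊛) ↠ G_{F_mod}`.

`GlobalFrobenioidsArithmeticModel.lean` instantiated abc-iut-L5-t1's `GlobalDivisorData` at `G_{F_mod}` itself
([FrdI] Example 6.3 as stated, `D = B(Gal(F̄/F))⁰`).  This sequel performs the PULL-BACK to an arbitrary profinite
`G = π₁(†𝒟^⊛)` equipped with a continuous surjection `ρ : G ↠ G_F = Gal(F̄/F)` (`F` in the role of `F_mod`),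
using only landed functors: abc-iut-L1's induction functor `φ_*` of [FrdII] Example 1.3 (ii)
(`QuasiTemperoid.inductionFunctorConnected`, a connected `G`-set `A ↦ G_F ×^G A = G_F/ρ(Stab a)`) and the
Galois correspondence `QuasiTemperoid.galoisSubext` (p416343):

* `isOfFSMType_baseCat` — `†𝒟^⊛ = ℬ(G)⁰` is of FSM-type ([FrdI] §0) for every profinite `G` (transport of
  abc-iut-L1's `connectedPart_isOfFSMType` for `B^temp(G)⁰` along `BCat.connectedToBTemp`);
* `isMonoidOn_comp_of_isOfFSMType` — a monoid on `D₂` composed with ANY functor from a category of FSM-type is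
  a monoid ([FrdI] Def 1.1 (ii)); no equivalence is needed;
* `subfieldFunctor ρ hρ : BaseCat G ⥤ FinSubextCat F F̄` — `A ↦` "the corresponding subfield `𝕄̄^⊛(†𝒟^⊚)^A`"
  `= F̄^{ρ(Stab a_A)}` (up to the `G_F`-conjugation fixed by the chosen base points);
* `GlobalDivisorData.arithAlong ρ hρ : GlobalDivisorData G` — `(Φ ∘ subfieldFunctor, B ∘ subfieldFunctor, Div_B ∘ −)`
  for L1's [FrdI] Example 6.3 data, i.e. print's `(Φ^⊛(†𝒟^⊚), 𝔹, 𝕄^⊛(†𝒟^⊚)^A → Φ^⊛(A)^gp)`;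
* `arithAlong_isMonoidOn_Φ` / `_isDivisorial` / `_isMonoidOn_B` / `_isGroupLike` / `arithAlong_hypotheses` — the
  [FrdI] Thm 5.2 hypotheses DISCHARGED; **`isFrobenioid_arithAlong`** / `isOfIsotropicType_arithAlong` —
  "`ℱ^⊛(†𝒟^⊚)` … a model Frobenioid" IS a Frobenioid of isotropic type, UNCONDITIONALLY;
  `nonempty_rationalFunctionMonoidStr_arithAlong` — Ex 5.1 (iv) "`𝒪^×(A^birat)` = `K(A)^×`";
* `GlobalFrobenioid.isFrobenioid_equivToElem_arithAlong` / `fmod_isFrobenioid_arithAlong` (and `…_arith` for the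
  `G_F`-model) — Ex 5.1 (iii)'s "`†ℱ^⊛` is equipped with a natural Frobenioid structure" and "`†ℱ^⊛_mod` … the
  Frobenioid of arithmetic line bundles on `S_mod`" UNCONDITIONAL at the models; `fcirc_isFrobenioid_arithAlong` —
  `†ℱ^⊚` modulo only the [FrdI] Prop 1.6 base-change inputs (abc-iut-w4-d050's p412721/p413623 with the
  [FrdI] Thm 5.2 inputs discharged);
* `subsingleton_of_isTerminal` — a terminal object of `ℬ(G)⁰` ("`C_{F_mod}`", p. 126) is a one-point `G`-set;
  `arith_field_terminal` / `arith_primes_terminal` — for the model of `GlobalFrobenioidsArithmeticModel.lean`,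
  the number field of a terminal object is `F` itself (the bottom subextension) and Ex 5.1 (v)'s
  "`Prime(†ℱ^⊛_mod) ⥲ 𝕍_mod`" (p. 129) holds there as the bijection primes ↔ places of abc-iut-L1's
  `Ex63_primes_holds`.

"Stack-theoretic" caveat as in the companion file (Remark 3.1.5: isomorphic to [FrdI] Example 6.3 as stated after
perfection or realification; L1 types Example 6.3 as stated).  No new Prop fact; no statement of the paper is
strengthened; no side is taken on [IUTchIII] Cor. 3.12.
-/

noncomputable section

namespace Literature.IUT.HodgeTheaters

open CategoryTheory Opposite Literature.AlgebraicGeometry.Frobenioids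
open Literature.AlgebraicGeometry.Frobenioids.QuasiTemperoid Literature.AnabelianGeometry.SemiGraphs

universe w v₁ v₂ u₁ u₂ u

/-! ### `ℬ(G)⁰` is of FSM-type; monoids pull back along functors out of FSM-type categories -/

/-- **`†𝒟^⊛ = ℬ(G)⁰` is of FSM-type** ([FrdI] §0: every FSM-morphism is an isomorphism), `G` profinite: an
FSM-morphism of `ℬ(G)⁰` is carried by the equivalence `ℬ(G)⁰ ≌ B^temp(G)⁰` (`BCat.connectedToBTemp`, abc-iut-found's
`IsFSM.map_equivalence`) to an FSM-morphism of `B^temp(G)⁰`, which is an isomorphism (abc-iut-L1's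
`connectedPart_isOfFSMType`), and equivalences reflect isomorphisms.
([IUTchI] Ex 5.1 (i) p.123; [FrdI] §0) [claim: Mochizuki2012, status: disputed] -/
theorem isOfFSMType_baseCat (G : ProfiniteGrp.{u}) : IsOfFSMType (BaseCat G) := by
  haveI := BCat.connectedToBTemp_isEquivalence (G := G)
  refine ⟨fun {A B} f hf => ?_⟩
  let e := (BCat.connectedToBTemp G).asEquivalence
  haveI : IsIso (e.functor.map f) :=
    BTempConnected.connectedPart_isOfFSMType.isIso_of_isFSM _ (hf.map_equivalence e)
  exact isIso_of_map_isIso_equivalence e f inferInstance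

/-- The underlying map of an isomorphism of `CommMonCat` is bijective. ([IUTchI] Ex 5.1 (ii) p.125; [FrdI] Def 1.1 (ii))
[claim: Mochizuki2012, status: disputed] -/
theorem bijective_hom_of_isIso_commMonCat {X Y : CommMonCat.{w}} (f : X ⟶ Y) [IsIso f] :
    Function.Bijective f.hom := by
  refine Function.bijective_iff_has_inverse.mpr ⟨(inv f).hom, fun x => ?_, fun y => ?_⟩
  · change (f ≫ inv f).hom x = x
    rw [IsIso.hom_inv_id]
    rfl
  · change (inv f ≫ f).hom y = y
    rw [IsIso.inv_hom_id]
    rfl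

/-- A monoid `Φ` on `D₂` ([FrdI] Def 1.1 (ii)) composed with ANY functor `E : D₁ ⥤ D₂` out of a category `D₁` of
FSM-type is a monoid on `D₁`: pull-backs along `α` are the (characteristically injective) pull-backs along
`E(α)`, and an FSM-morphism `α` of `D₁` is an isomorphism, so `E(α)` is and its pull-back is bijective.
([IUTchI] Ex 5.1 (ii) p.125; [FrdI] Def 1.1 (ii)) [claim: Mochizuki2012, status: disputed] -/
theorem isMonoidOn_comp_of_isOfFSMType {D₁ : Type u₁} [Category.{v₁} D₁] {D₂ : Type u₂} [Category.{v₂} D₂]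
    (E : D₁ ⥤ D₂) (h₁ : IsOfFSMType D₁) {Φ : D₂ᵒᵖ ⥤ CommMonCat.{w}} (hΦ : IsMonoidOn Φ) :
    IsMonoidOn (E.op ⋙ Φ) where
  isCharInjective α := hΦ.isCharInjective (E.map α)
  bijective_of_isFSM α hα := by
    haveI := h₁.isIso_of_isFSM α hα
    exact bijective_hom_of_isIso_commMonCat ((E.op ⋙ Φ).map α.op)

/-! ### `A ↦` "the corresponding subfield `𝕄̄^⊛(†𝒟^⊚)^A`" along `ρ : π₁(†𝒟^⊛) ↠ G_F` -/

section Along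

variable {G : ProfiniteGrp.{0}} (F : Type) [Field F] [NumberField F] (ρ : G →ₜ* GalFbar F)

/-- A continuous surjection of profinite groups `G ↠ G_F` is an OPEN map (Mathlib's open mapping theorem for
σ-compact groups onto Baire groups). ([IUTchI] Ex 5.1 (i) p.123) [claim: Mochizuki2012, status: disputed] -/
theorem isOpenMap_of_surjective (hρ : Function.Surjective ρ) : IsOpenMap ρ := by
  haveI : IsGalois F (Fbar F) := isGalois_fbar F
  exact MonoidHom.isOpenMap_of_sigmaCompact ρ.toMonoidHom hρ ρ.continuous

/-- Open subgroups of the profinite group `G_F` have finite, hence countable, index.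
([IUTchI] Ex 5.1 (i) p.123) [claim: Mochizuki2012, status: disputed] -/
theorem countable_quotient_of_isOpen (U : Subgroup (GalFbar F)) (hU : IsOpen (U : Set (GalFbar F))) :
    Countable (GalFbar F ⧸ U) := by
  haveI : IsGalois F (Fbar F) := isGalois_fbar F
  haveI := Subgroup.quotient_finite_of_isOpen U hU
  infer_instance

/-- **"the corresponding subfield `𝕄̄^⊛(†𝒟^⊚)^A ⊆ 𝕄̄^⊛(†𝒟^⊚)`"** (p. 125) as a functor
`†𝒟^⊛ = ℬ(G)⁰ ⥤ FinSubextCat F F̄` for `G = π₁(†𝒟^⊛)` acting on `F̄` through the continuous surjection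
`ρ : G ↠ G_F`: a connected finite `G`-set `A` goes to the connected tempered `G`-set `A` (`BCat.connectedToBTemp`),
then to the induced `G_F`-set `G_F ×^G A = G_F/ρ(Stab a)` (abc-iut-L1's [FrdII] Ex 1.3 (ii) induction functor
`inductionFunctorConnected`, `ρ` being open), then to the fixed field of the stabiliser of its base point
(`galoisSubext`), i.e. to [a `G_F`-conjugate of] `F̄^{ρ(Stab a)}`, the field of `ρ(Stab a)`-invariants.
([IUTchI] Ex 5.1 (ii) p.125) [claim: Mochizuki2012, status: disputed] -/
def subfieldFunctor (hρ : Function.Surjective ρ) : BaseCat G ⥤ FinSubextCat F (Fbar F) :=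
  BCat.connectedToBTemp G ⋙
    inductionFunctorConnected ρ.toMonoidHom (isOpenMap_of_surjective F ρ hρ) (countable_quotient_of_isOpen F) ⋙
      galoisSubext F

/-! ### The divisor data of Example 5.1 (ii) over a general `†𝒟^⊛` -/

namespace GlobalDivisorData

variable (hρ : Function.Surjective ρ)

/-- **[IUTchI] Ex 5.1 (ii) over `†𝒟^⊛ = ℬ(G)⁰`, `G = π₁(†𝒟^⊛) ↠ G_{F_mod}`**: the divisor data
`(Φ^⊛(†𝒟^⊚), 𝔹, 𝕄^⊛(†𝒟^⊚)^A → Φ^⊛(†𝒟^⊚)(A)^gp)` — abc-iut-L1's [FrdI] Example 6.3 data `(arithDivisorFunctor,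
unitsFunctor, divNatTrans)` over `FinSubextCat F F̄` composed with `subfieldFunctor ρ` ("arithmetic divisors on
the corresponding subfield", "the natural morphism of monoids").  ([IUTchI] Ex 5.1 (ii) p.125)
[claim: Mochizuki2012, status: disputed] -/
def arithAlong : GlobalDivisorData G where
  Φ := (subfieldFunctor F ρ hρ).op ⋙ arithDivisorFunctor F (Fbar F)
  B := (subfieldFunctor F ρ hρ).op ⋙ unitsFunctor F (Fbar F)
  div := Functor.whiskerLeft (subfieldFunctor F ρ hρ).op (divNatTrans F (Fbar F))

/-- `Φ^⊛(A)` is the monoid of effective arithmetic divisors of "the corresponding subfield".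
([IUTchI] Ex 5.1 (ii) p.125) [claim: Mochizuki2012, status: disputed] -/
theorem arithAlong_Φ_obj (A : BaseCat G) :
    ((arithAlong F ρ hρ).Φ.obj (op A) : Type) =
      Multiplicative (EffArithDivisor ((subfieldFunctor F ρ hρ).obj A).L) := rfl

/-- `𝔹(A)` is the unit group `(𝕄̄^⊛(†𝒟^⊚)^A)^×` of "the corresponding subfield".
([IUTchI] Ex 5.1 (ii) p.125) [claim: Mochizuki2012, status: disputed] -/
theorem arithAlong_B_obj (A : BaseCat G) :
    ((arithAlong F ρ hρ).B.obj (op A) : Type) = (↥((subfieldFunctor F ρ hρ).obj A).L)ˣ := rfl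

/-- **[FrdI] Thm 5.2 hypothesis (1) DISCHARGED over `†𝒟^⊛`: `Φ^⊛` is a monoid on `†𝒟^⊛`** (L1's
`arithDivisorFunctor_isMonoidOn`, composed with `subfieldFunctor ρ` out of the FSM-type category `ℬ(G)⁰`).
([IUTchI] Ex 5.1 (ii) p.125) [claim: Mochizuki2012, status: disputed] -/
theorem arithAlong_isMonoidOn_Φ : IsMonoidOn (arithAlong F ρ hρ).Φ := by
  haveI : IsGalois F (Fbar F) := isGalois_fbar F
  exact isMonoidOn_comp_of_isOfFSMType (subfieldFunctor F ρ hρ) (isOfFSMType_baseCat G)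
    (arithDivisorFunctor_isMonoidOn F (Fbar F))

/-- **[FrdI] Thm 5.2 hypothesis (2) DISCHARGED over `†𝒟^⊛`: `Φ^⊛` is divisorial.**
([IUTchI] Ex 5.1 (ii) p.125) [claim: Mochizuki2012, status: disputed] -/
theorem arithAlong_isDivisorial : Objectwise (fun M _ => IsDivisorial M) (arithAlong F ρ hρ).Φ :=
  objectwise_comp (subfieldFunctor F ρ hρ) (arithDivisorFunctor_isDivisorial F (Fbar F))

/-- **[FrdI] Thm 5.2 hypothesis (3) DISCHARGED over `†𝒟^⊛`: `𝔹` is a monoid on `†𝒟^⊛`.**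
([IUTchI] Ex 5.1 (ii) p.125) [claim: Mochizuki2012, status: disputed] -/
theorem arithAlong_isMonoidOn_B : IsMonoidOn (arithAlong F ρ hρ).B := by
  haveI : IsGalois F (Fbar F) := isGalois_fbar F
  exact isMonoidOn_comp_of_isOfFSMType (subfieldFunctor F ρ hρ) (isOfFSMType_baseCat G)
    (unitsFunctor_isMonoidOn F (Fbar F))

/-- **[FrdI] Thm 5.2 hypothesis (4) DISCHARGED over `†𝒟^⊛`: `𝔹` is group-like.**
([IUTchI] Ex 5.1 (ii) p.125) [claim: Mochizuki2012, status: disputed] -/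
theorem arithAlong_isGroupLike : Objectwise (fun M _ => IsGroupLike M) (arithAlong F ρ hρ).B :=
  objectwise_comp (subfieldFunctor F ρ hρ) (unitsFunctor_isGroupLike F (Fbar F))

/-- ALL standing hypotheses of [FrdI] Thm 5.2 for `(Φ^⊛, 𝔹)` over `†𝒟^⊛ = ℬ(G)⁰` (`ModelFrobenioid.Hypotheses`).
([IUTchI] Ex 5.1 (ii) p.125) [claim: Mochizuki2012, status: disputed] -/
theorem arithAlong_hypotheses : ModelFrobenioid.Hypotheses (arithAlong F ρ hρ).Φ (arithAlong F ρ hρ).B where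
  isMonoidOn := arithAlong_isMonoidOn_Φ F ρ hρ
  isDivisorial := arithAlong_isDivisorial F ρ hρ
  isMonoidOn_rat := arithAlong_isMonoidOn_B F ρ hρ
  isGroupLike_rat := arithAlong_isGroupLike F ρ hρ
  isGraphConnected := isGraphConnected_baseCat G
  isTotallyEpimorphic := isTotallyEpimorphic_baseCat G

/-- **[IUTchI] Ex 5.1 (ii) over a general `†𝒟^⊛`, UNCONDITIONAL**: "this data determines, by applying [FrdI],
Theorem 5.2, (ii), a model Frobenioid `ℱ^⊛(†𝒟^⊚)` over the base category `†𝒟^⊛`" — the structure functor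
`ℱ^⊛(†𝒟^⊚) → F_{Φ^⊛}` of the model Frobenioid of `arithAlong ρ` IS a Frobenioid.
([IUTchI] Ex 5.1 (ii) p.125) [claim: Mochizuki2012, status: disputed] -/
theorem isFrobenioid_arithAlong :
    PreFrobenioid.IsFrobenioid
      (ModelFrobenioid.toElem (arithAlong F ρ hρ).Φ (arithAlong F ρ hρ).B (arithAlong F ρ hρ).div) :=
  (arithAlong F ρ hρ).isFrobenioid_model (arithAlong_isMonoidOn_Φ F ρ hρ) (arithAlong_isDivisorial F ρ hρ)
    (arithAlong_isMonoidOn_B F ρ hρ) (arithAlong_isGroupLike F ρ hρ)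

/-- … of ISOTROPIC type, unconditionally. ([IUTchI] Ex 5.1 (ii) p.125) [claim: Mochizuki2012, status: disputed] -/
theorem isOfIsotropicType_arithAlong :
    PreFrobenioid.IsOfIsotropicType
      (ModelFrobenioid.toElem (arithAlong F ρ hρ).Φ (arithAlong F ρ hρ).B (arithAlong F ρ hρ).div) :=
  (arithAlong F ρ hρ).isOfIsotropicType_model (arithAlong_isGroupLike F ρ hρ)

/-- **[IUTchI] Ex 5.1 (iv) over a general `†𝒟^⊛`**: "`𝒪^×(A^birat)` … may be naturally identified with the
multiplicative group of non-zero elements of the number field corresponding to `A`" — the rational-function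
monoid of the birationalization IS `𝔹`, compatibly with divisors (L1's `rationalFunctionMonoidIsB_holds`).
([IUTchI] Ex 5.1 (iv) p.126) [claim: Mochizuki2012, status: disputed] -/
theorem nonempty_rationalFunctionMonoidStr_arithAlong :
    Nonempty (PreFrobenioid.RationalFunctionMonoidStr
      (ModelFrobenioid.toElem (arithAlong F ρ hρ).Φ (arithAlong F ρ hρ).B (arithAlong F ρ hρ).div)
      (isFrobenioid_arithAlong F ρ hρ) (arithAlong F ρ hρ).B (arithAlong F ρ hρ).div) :=
  ModelFrobenioid.rationalFunctionMonoidIsB_holds _ _ _ (arithAlong_hypotheses F ρ hρ)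
    (isFrobenioid_arithAlong F ρ hρ)

end GlobalDivisorData

end Along

/-! ### Terminal objects of `†𝒟^⊛` ("`C_{F_mod}`") and "`Prime(†ℱ^⊛_mod) ⥲ 𝕍_mod`" at the model -/

/-- A terminal object of `†𝒟^⊛ = ℬ(G)⁰` is a ONE-POINT `G`-set: the unique morphism from the one-point object
hits a `G`-fixed point, whose orbit — the whole (connected = transitive) object — is that point.
([IUTchI] Ex 5.1 (iii) p.126) [claim: Mochizuki2012, status: disputed] -/
theorem subsingleton_of_isTerminal {G : ProfiniteGrp.{u}} {T : BaseCat G} (hT : Limits.IsTerminal T) :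
    Subsingleton T.obj.obj.V := by
  obtain ⟨P, p₀, hP, hp⟩ := NFLocCat.exists_point_obj G
  let f : (⟨P, hP⟩ : BaseCat G) ⟶ T := hT.from _
  let t₀ : T.obj.obj.V := f.hom.hom.hom p₀
  have hfix : ∀ g : G, g • t₀ = t₀ := fun g => by
    change g • f.hom.hom.hom p₀ = f.hom.hom.hom p₀
    rw [← BCat.hom_smul f.hom g p₀, hp (g • p₀)]
  refine ⟨fun a b => ?_⟩
  obtain ⟨g, rfl⟩ := BCat.exists_smul_eq_of_isConnectedObj T.obj T.property t₀ a
  obtain ⟨g', rfl⟩ := BCat.exists_smul_eq_of_isConnectedObj T.obj T.property t₀ b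
  rw [hfix, hfix]

section Terminal

variable (F : Type) [Field F] [NumberField F]

/-- For the arithmetic model of `GlobalFrobenioidsArithmeticModel.lean` (`†𝒟^⊛ = ℬ(G_F)⁰`): the number field
"corresponding to" a one-point object — in particular to a terminal object "`C_{F_mod}`" — is the bottom
subextension `F ⊆ F̄`, i.e. `F` ("`F_mod`") itself: its stabiliser is all of `G_F`, whose fixed field is `F`
(Krull's correspondence). ([IUTchI] Ex 5.1 (iii) p.126) [claim: Mochizuki2012, status: disputed] -/
theorem arith_field_of_subsingleton (A : BaseCat (absGalGrp F)) [Subsingleton A.obj.obj.V] :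
    ((galoisSubextOfFinite F).obj A).L = ⊥ := by
  haveI : IsGalois F (Fbar F) := isGalois_fbar F
  rw [galoisSubextOfFinite_obj_L, fixFld]
  haveI : Subsingleton ((BCat.connectedToBTemp (GalFbar F)).obj A).obj.obj.V := ‹Subsingleton A.obj.obj.V›
  have htop : stabilizerSubgroup ((BCat.connectedToBTemp (GalFbar F)).obj A).obj
      (basePt ((BCat.connectedToBTemp (GalFbar F)).obj A)) = ⊤ := by
    refine eq_top_iff.mpr fun g _ => ?_
    rw [mem_stabilizerSubgroup_iff]
    exact Subsingleton.elim _ _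
  rw [htop, ← IntermediateField.fixingSubgroup_bot, InfiniteGalois.fixedField_fixingSubgroup]

/-- … in particular for a terminal object `A₀` ("`C_{F_mod}`") of `†𝒟^⊛`.
([IUTchI] Ex 5.1 (iii) p.126) [claim: Mochizuki2012, status: disputed] -/
theorem arith_field_terminal {A₀ : BaseCat (absGalGrp F)} (hA₀ : Limits.IsTerminal A₀) :
    ((galoisSubextOfFinite F).obj A₀).L = ⊥ :=
  haveI := subsingleton_of_isTerminal hA₀
  arith_field_of_subsingleton F A₀

/-- **[IUTchI] Ex 5.1 (v), "the natural bijection `Prime(†ℱ^⊛_mod) ⥲ 𝕍_mod`" (p. 129), at the arithmetic model**: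
for a terminal object `A₀` of `†𝒟^⊛` the primes of the divisor monoid `Φ^⊛(A₀)` are in natural bijection with the
places of the number field of `A₀` (abc-iut-L1's [FrdI] Ex 6.3 `Ex63_primes_holds`: `v ↦` the prime of the
prime divisor `[v]`), and that number field is `F = "F_mod"` (`arith_field_terminal`), whose places are `𝕍_mod`.
([IUTchI] Ex 5.1 (v) p.129) [claim: Mochizuki2012, status: disputed] -/
theorem arith_primes_terminal {A₀ : BaseCat (absGalGrp F)} (hA₀ : Limits.IsTerminal A₀) :
    Ex63_primes ((galoisSubextOfFinite F).obj A₀).L ∧ ((galoisSubextOfFinite F).obj A₀).L = ⊥ :=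
  ⟨Ex63_primes_holds _, arith_field_terminal F hA₀⟩

end Terminal

/-! ### Consequences for `†ℱ^⊛`, `†ℱ^⊚`, `†ℱ^⊛_mod` (Example 5.1 (iii), pp. 125–126) at the models -/

namespace GlobalFrobenioid

section AlongModel

variable {G : ProfiniteGrp.{0}} {F : Type} [Field F] [NumberField F] {ρ : G →ₜ* GalFbar F}
  {hρ : Function.Surjective ρ} {Dcirc : Type 1} [Category.{0} Dcirc] {toBase0 : Dcirc ⥤ BaseCat G}
  (𝓕 : GlobalFrobenioid (GlobalDivisorData.arithAlong F ρ hρ) Dcirc toBase0)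

/-- **[IUTchI] Ex 5.1 (iii) "`†ℱ^⊛` is equipped with a natural Frobenioid structure" — UNCONDITIONAL over a general
`†𝒟^⊛`** for any `†ℱ^⊛` equivalent to `ℱ^⊛(†𝒟^⊚)` of the model `arithAlong ρ` (abc-iut-w4-d050's
`isFrobenioid_equivToElem` with the [FrdI] Thm 5.2 hypotheses discharged).
([IUTchI] Ex 5.1 (iii) p.125) [claim: Mochizuki2012, status: disputed] -/
theorem isFrobenioid_equivToElem_arithAlong :
    PreFrobenioid.IsFrobenioid (𝓕.equiv.functor ⋙ ModelFrobenioid.toElem _ _ (GlobalDivisorData.arithAlong F ρ hρ).div) :=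
  𝓕.isFrobenioid_equivToElem (GlobalDivisorData.arithAlong_isMonoidOn_Φ F ρ hρ)
    (GlobalDivisorData.arithAlong_isDivisorial F ρ hρ) (GlobalDivisorData.arithAlong_isMonoidOn_B F ρ hρ)
    (GlobalDivisorData.arithAlong_isGroupLike F ρ hρ)

/-- **[IUTchI] Ex 5.1 (iii) "`†ℱ^⊛_mod` … the Frobenioid of arithmetic line bundles on the stack `S_mod`" IS a
Frobenioid — UNCONDITIONAL over a general `†𝒟^⊛`** (abc-iut-w4-d050's `fmod_isFrobenioid`, all inputs discharged).
([IUTchI] Ex 5.1 (iii) p.126) [claim: Mochizuki2012, status: disputed] -/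
theorem fmod_isFrobenioid_arithAlong :
    ∃ e : 𝓕.Fmod ≌ PreFrobenioid.FiberProduct
        (𝓕.equiv.functor ⋙ ModelFrobenioid.toElem _ _ (GlobalDivisorData.arithAlong F ρ hρ).div)
        (ObjectProperty.ι (fun X : BaseCat G => Nonempty (Limits.IsTerminal X))),
      (∀ A, (e.functor.obj A).fst = A.obj) ∧
      PreFrobenioid.IsFrobenioid (e.functor ⋙ PreFrobenioid.fiberProductFunctor
        (𝓕.equiv.functor ⋙ ModelFrobenioid.toElem _ _ (GlobalDivisorData.arithAlong F ρ hρ).div)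
        (ObjectProperty.ι (fun X : BaseCat G => Nonempty (Limits.IsTerminal X)))) :=
  𝓕.fmod_isFrobenioid (GlobalDivisorData.arithAlong_isMonoidOn_Φ F ρ hρ)
    (GlobalDivisorData.arithAlong_isDivisorial F ρ hρ) (GlobalDivisorData.arithAlong_isMonoidOn_B F ρ hρ)
    (GlobalDivisorData.arithAlong_isGroupLike F ρ hρ)

/-- **[IUTchI] Ex 5.1 (iii) "`†ℱ^⊚ := †ℱ^⊛|_{†𝒟^⊚}`" IS a Frobenioid over a general `†𝒟^⊛`, modulo ONLY the printed
[FrdI] Prop 1.6 base-change inputs on `†𝒟^⊚ → †𝒟^⊛`** (connected, totally epimorphic, FSM-morphisms to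
FSM-morphisms) — the [FrdI] Thm 5.2 inputs being discharged (abc-iut-w4-d050's `fcirc_isFrobenioid`).
([IUTchI] Ex 5.1 (iii) p.126) [claim: Mochizuki2012, status: disputed] -/
theorem fcirc_isFrobenioid_arithAlong (hDc : IsGraphConnected Dcirc) (hDe : IsTotallyEpimorphic Dcirc)
    (hFSM : ∀ {A A' : Dcirc} (f : A' ⟶ A), IsFSM f → IsFSM ((𝓕.baseMor ⋙ 𝓕.identify.functor).map f)) :
    ∃ e : 𝓕.Fcirc ≌ PreFrobenioid.FiberProduct
        (𝓕.equiv.functor ⋙ ModelFrobenioid.toElem _ _ (GlobalDivisorData.arithAlong F ρ hρ).div)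
        (𝓕.baseMor ⋙ 𝓕.identify.functor),
      (∀ X, (e.functor.obj X).fst = X.fst ∧ (e.functor.obj X).snd = X.snd) ∧
      PreFrobenioid.IsFrobenioid (e.functor ⋙ PreFrobenioid.fiberProductFunctor
        (𝓕.equiv.functor ⋙ ModelFrobenioid.toElem _ _ (GlobalDivisorData.arithAlong F ρ hρ).div)
        (𝓕.baseMor ⋙ 𝓕.identify.functor)) :=
  𝓕.fcirc_isFrobenioid (GlobalDivisorData.arithAlong_isMonoidOn_Φ F ρ hρ)
    (GlobalDivisorData.arithAlong_isDivisorial F ρ hρ) (GlobalDivisorData.arithAlong_isMonoidOn_B F ρ hρ)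
    (GlobalDivisorData.arithAlong_isGroupLike F ρ hρ) hDc hDe hFSM

end AlongModel

section GaloisModel

variable {F : Type} [Field F] [NumberField F] {Dcirc : Type 1} [Category.{0} Dcirc]
  {toBase0 : Dcirc ⥤ BaseCat (absGalGrp F)} (𝓕 : GlobalFrobenioid (GlobalDivisorData.arith F) Dcirc toBase0)

/-- The same for the `G_F`-model of `GlobalFrobenioidsArithmeticModel.lean`: "`†ℱ^⊛` is equipped with a natural
Frobenioid structure", UNCONDITIONAL. ([IUTchI] Ex 5.1 (iii) p.125) [claim: Mochizuki2012, status: disputed] -/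
theorem isFrobenioid_equivToElem_arith :
    PreFrobenioid.IsFrobenioid (𝓕.equiv.functor ⋙ ModelFrobenioid.toElem _ _ (GlobalDivisorData.arith F).div) :=
  𝓕.isFrobenioid_equivToElem (GlobalDivisorData.arith_isMonoidOn_Φ F) (GlobalDivisorData.arith_isDivisorial F)
    (GlobalDivisorData.arith_isMonoidOn_B F) (GlobalDivisorData.arith_isGroupLike F)

/-- … and "`†ℱ^⊛_mod` is a Frobenioid", UNCONDITIONAL at the `G_F`-model.
([IUTchI] Ex 5.1 (iii) p.126) [claim: Mochizuki2012, status: disputed] -/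
theorem fmod_isFrobenioid_arith :
    ∃ e : 𝓕.Fmod ≌ PreFrobenioid.FiberProduct
        (𝓕.equiv.functor ⋙ ModelFrobenioid.toElem _ _ (GlobalDivisorData.arith F).div)
        (ObjectProperty.ι (fun X : BaseCat (absGalGrp F) => Nonempty (Limits.IsTerminal X))),
      (∀ A, (e.functor.obj A).fst = A.obj) ∧
      PreFrobenioid.IsFrobenioid (e.functor ⋙ PreFrobenioid.fiberProductFunctor
        (𝓕.equiv.functor ⋙ ModelFrobenioid.toElem _ _ (GlobalDivisorData.arith F).div)
        (ObjectProperty.ι (fun X : BaseCat (absGalGrp F) => Nonempty (Limits.IsTerminal X)))) :=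
  𝓕.fmod_isFrobenioid (GlobalDivisorData.arith_isMonoidOn_Φ F) (GlobalDivisorData.arith_isDivisorial F)
    (GlobalDivisorData.arith_isMonoidOn_B F) (GlobalDivisorData.arith_isGroupLike F)

end GaloisModel

end GlobalFrobenioid

end Literature.IUT.HodgeTheaters

end
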